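import Summits.CriticalPhenomena.CardyFormulaZ2.Theorems.CardyBoundaryCoulombGasRectilinearCardyStubBoundaryFeetPart3
import Summits.CriticalPhenomena.CardyFormulaZ2.Theorems.CardyBoundaryCoulombGasBoundaryDefectGaussianRStubTransportPathsPart18
import HarnessLib

/-!
# Stub `stub_boundaryFeet` of line `excursion-kernel-covariance` — Part 4:
# the local chain of exterior darts in a lattice sector (crux `RectilinearCardy`,
# stmt-CriticalPhenomena-5660)

Pure `ℤ²` combinatorics. In the frame `K` with thresholds `X` (along `dir K`) and `Y` (along
`dir (K+1)`), the lattice sector of type `m` is the quadrant `X ≤ al ∧ Y ≤ pe` (`m = 1`), the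
half-plane `Y ≤ pe` (`m = 2`) or the co-quadrant `Y ≤ pe ∨ al ≤ X` (`m = 3`). Its exterior
darts form ONE chain `bftVert m K X Y ι`, `ι ∈ ℤ`, with out-direction `K + bftKoff m ι`:
the forward rail `((X [+1]) + ι, Y)`, `ι ≥ 0`, pointing along `dir (K+3)`, preceded (for
`m ≠ 2`) by the backward rail on the column `al = X` (pointing along `dir (K+2)` for the
quadrant, along `dir K` for the co-quadrant; for `m = 2` the forward rail continues to `ι < 0`).

* `bft_enum` — every exterior dart at a vertex carrying the frame chart is a chain dart;
* `bft_ext_succ` — chain darts are exterior and the boundary walk moves along the chain: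
  `dsucc (dart ι) = dart (ι + 1)`;
* `bft_vert_step`, `bft_vert_shift` — consecutive chain vertices are frame-adjacent.
All [folklore].
-/

noncomputable section

open Set
open Literature.Probability.RandomPlanarGeometry
open Literature.Probability.LatticeModels Literature.Probability.LatticeModels.CollarLegModel
open Summit.CriticalPhenomena.CardyFormulaZ2.Cruxes.BoundaryDefectGaussianR.RainbowMonomialsInExcursionKernels

namespace Summit.CriticalPhenomena.CardyFormulaZ2.Cruxes.RectilinearCardy.ExcursionKernelCovariance

/-! ### The chain -/

/-- The vertex of the `ι`-th dart of the local chain of the sector of type `m` (frame `K`,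
thresholds `X`, `Y`). [folklore] -/
def bftVert (m : ℕ) (K : Fin 4) (X Y ι : ℤ) : ℤ × ℤ :=
  if m = 2 ∨ 0 ≤ ι then (X + (if m = 3 then 1 else 0) + ι) • dir K + Y • dir (K + 1)
  else X • dir K + (if m = 3 then Y + ι else Y - 1 - ι) • dir (K + 1)

/-- The out-direction offset (relative to the frame `K`) of the `ι`-th chain dart. [folklore] -/
def bftKoff (m : ℕ) (ι : ℤ) : Fin 4 :=
  if m = 2 ∨ 0 ≤ ι then 3 else if m = 3 then 0 else 2

/-- The index of the chain dart `(v, k)`, read off its frame coordinates. [folklore] -/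
def bftIdx (m : ℕ) (K : Fin 4) (X Y : ℤ) (v : ℤ × ℤ) (k : Fin 4) : ℤ :=
  if k = K + 3 then v.1 * (dir K).1 + v.2 * (dir K).2 - X - (if m = 3 then 1 else 0)
  else if m = 3 then v.1 * (dir (K + 1)).1 + v.2 * (dir (K + 1)).2 - Y
  else Y - 1 - (v.1 * (dir (K + 1)).1 + v.2 * (dir (K + 1)).2)

/-- Forward chain vertices. [folklore] -/
theorem bft_vert_fwd {m : ℕ} (K : Fin 4) (X Y : ℤ) {ι : ℤ} (h : m = 2 ∨ 0 ≤ ι) :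
    bftVert m K X Y ι = (X + (if m = 3 then 1 else 0) + ι) • dir K + Y • dir (K + 1) ∧
      bftKoff m ι = 3 := by
  simp only [bftVert, bftKoff, if_pos h, and_self]

/-- Backward chain vertices of a quadrant. [folklore] -/
theorem bft_vert_bwd_one (K : Fin 4) (X Y : ℤ) {ι : ℤ} (h : ι < 0) :
    bftVert 1 K X Y ι = X • dir K + (Y - 1 - ι) • dir (K + 1) ∧ bftKoff 1 ι = 2 := by
  have h' : ¬ ((1 : ℕ) = 2 ∨ 0 ≤ ι) := by omega
  simp only [bftVert, bftKoff, if_neg h', show ¬ ((1 : ℕ) = 3) by norm_num, if_false, and_self]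

/-- Backward chain vertices of a co-quadrant. [folklore] -/
theorem bft_vert_bwd_three (K : Fin 4) (X Y : ℤ) {ι : ℤ} (h : ι < 0) :
    bftVert 3 K X Y ι = X • dir K + (Y + ι) • dir (K + 1) ∧ bftKoff 3 ι = 0 := by
  have h' : ¬ ((3 : ℕ) = 2 ∨ 0 ≤ ι) := by omega
  simp only [bftVert, bftKoff, if_neg h', if_true, and_self]

/-- The four directions relative to a frame. [folklore] -/
theorem bft_dir_cases (K k : Fin 4) : k = K + 0 ∨ k = K + 1 ∨ k = K + 2 ∨ k = K + 3 := by
  revert K k; decide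

/-- Small `Fin 4` facts used to read the index of a chain dart. [folklore] -/
theorem bft_fin_facts (K : Fin 4) : (K + 0 = K + 3 ↔ False) ∧ (K + 1 = K + 3 ↔ False) ∧
    (K + 2 = K + 3 ↔ False) ∧ K + 0 = K := by
  revert K; decide

/-- Frame forms of the four unit steps. [folklore] -/
theorem bft_step_frame (K : Fin 4) (v : ℤ × ℤ) :
    v + dir (K + 0) = v + (1 : ℤ) • dir K + (0 : ℤ) • dir (K + 1) ∧
    v + dir (K + 1) = v + (0 : ℤ) • dir K + (1 : ℤ) • dir (K + 1) ∧
    v + dir (K + 2) = v + (-1 : ℤ) • dir K + (0 : ℤ) • dir (K + 1) ∧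
    v + dir (K + 3) = v + (0 : ℤ) • dir K + (-1 : ℤ) • dir (K + 1) := by
  rw [add_zero, tp_dir_add_two, tp_dir_add_three]
  refine ⟨?_, ?_, ?_, ?_⟩ <;> module

/-! ### Enumeration -/

/-- **Every exterior dart inside a frame chart is a chain dart.** If on the frame box of radius
`2` about `v` membership in `V` is the sector predicate of type `m`, `v ∈ V` and `v + dir k ∉ V`,
then `(v, k)` is the chain dart of index `bftIdx m K X Y v k`. [folklore] -/
theorem bft_enum (V : Finset (ℤ × ℤ)) {m : ℕ} (hm : m = 1 ∨ m = 2 ∨ m = 3) (K : Fin 4) (X Y : ℤ)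
    (v : ℤ × ℤ) (k : Fin 4)
    (hch : ∀ s t : ℤ, -2 ≤ s → s ≤ 2 → -2 ≤ t → t ≤ 2 →
      (v + s • dir K + t • dir (K + 1) ∈ V ↔
        ((m = 1 → X ≤ v.1 * (dir K).1 + v.2 * (dir K).2 + s ∧
            Y ≤ v.1 * (dir (K + 1)).1 + v.2 * (dir (K + 1)).2 + t) ∧
          (m = 2 → Y ≤ v.1 * (dir (K + 1)).1 + v.2 * (dir (K + 1)).2 + t) ∧
          (m = 3 → Y ≤ v.1 * (dir (K + 1)).1 + v.2 * (dir (K + 1)).2 + t ∨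
            v.1 * (dir K).1 + v.2 * (dir K).2 + s ≤ X))))
    (hv : v ∈ V) (hk : v + dir k ∉ V) :
    v = bftVert m K X Y (bftIdx m K X Y v k) ∧ k = K + bftKoff m (bftIdx m K X Y v k) := by
  have hdec := tp_decomp K v
  obtain ⟨e0, e1, e2, e3⟩ := bft_step_frame K v
  obtain ⟨f0, f1, f2, f00⟩ := bft_fin_facts K
  simp only [bftIdx]
  generalize hal : v.1 * (dir K).1 + v.2 * (dir K).2 = al at *
  generalize hpe : v.1 * (dir (K + 1)).1 + v.2 * (dir (K + 1)).2 = pe at *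
  have h00 := (hch 0 0 (by norm_num) (by norm_num) (by norm_num) (by norm_num)).1
    (by simpa using hv)
  simp only [add_zero] at h00
  rcases bft_dir_cases K k with rfl | rfl | rfl | rfl
  · -- `k = K`: only the co-quadrant column
    have htip : ¬ ((m = 1 → X ≤ al + 1 ∧ Y ≤ pe + 0) ∧ (m = 2 → Y ≤ pe + 0) ∧
        (m = 3 → Y ≤ pe + 0 ∨ al + 1 ≤ X)) := fun h =>
      hk (e0 ▸ (hch 1 0 (by norm_num) (by norm_num) (by norm_num) (by norm_num)).2 h)
    simp only [f0, if_false]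
    rcases hm with rfl | rfl | rfl
    · exfalso; rw [bft_mem_one] at h00 htip; omega
    · exfalso; rw [bft_mem_two] at h00 htip; omega
    · rw [bft_mem_three] at h00 htip
      simp only [if_true]
      have hneg : pe - Y < 0 := by omega
      have hX : al = X := by omega
      rw [(bft_vert_bwd_three K X Y hneg).1, (bft_vert_bwd_three K X Y hneg).2,
        show Y + (pe - Y) = pe by ring, ← hX]
      exact ⟨hdec, by simp [f00]⟩
  · -- `k = K + 1`: impossible
    have htip : ¬ ((m = 1 → X ≤ al + 0 ∧ Y ≤ pe + 1) ∧ (m = 2 → Y ≤ pe + 1) ∧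
        (m = 3 → Y ≤ pe + 1 ∨ al + 0 ≤ X)) := fun h =>
      hk (e1 ▸ (hch 0 1 (by norm_num) (by norm_num) (by norm_num) (by norm_num)).2 h)
    exfalso
    rcases hm with rfl | rfl | rfl
    · rw [bft_mem_one] at h00 htip; omega
    · rw [bft_mem_two] at h00 htip; omega
    · rw [bft_mem_three] at h00 htip; omega
  · -- `k = K + 2`: only the quadrant column
    have htip : ¬ ((m = 1 → X ≤ al + (-1) ∧ Y ≤ pe + 0) ∧ (m = 2 → Y ≤ pe + 0) ∧
        (m = 3 → Y ≤ pe + 0 ∨ al + (-1) ≤ X)) := fun h =>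
      hk (e2 ▸ (hch (-1) 0 (by norm_num) (by norm_num) (by norm_num) (by norm_num)).2 h)
    simp only [f2, if_false]
    rcases hm with rfl | rfl | rfl
    · rw [bft_mem_one] at h00 htip
      simp only [show ¬ ((1 : ℕ) = 3) by norm_num, if_false]
      have hneg : Y - 1 - pe < 0 := by omega
      have hX : al = X := by omega
      rw [(bft_vert_bwd_one K X Y hneg).1, (bft_vert_bwd_one K X Y hneg).2,
        show Y - 1 - (Y - 1 - pe) = pe by ring, ← hX]
      exact ⟨hdec, rfl⟩
    · exfalso; rw [bft_mem_two] at h00 htip; omega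
    · exfalso; rw [bft_mem_three] at h00 htip; omega
  · -- `k = K + 3`: the forward rail
    have htip : ¬ ((m = 1 → X ≤ al + 0 ∧ Y ≤ pe + (-1)) ∧ (m = 2 → Y ≤ pe + (-1)) ∧
        (m = 3 → Y ≤ pe + (-1) ∨ al + 0 ≤ X)) := fun h =>
      hk (e3 ▸ (hch 0 (-1) (by norm_num) (by norm_num) (by norm_num) (by norm_num)).2 h)
    simp only [if_true]
    have hfwd : m = 2 ∨ 0 ≤ al - X - (if m = 3 then 1 else 0) := by
      rcases hm with rfl | rfl | rfl
      · rw [bft_mem_one] at h00 htip; right; rw [if_neg (by norm_num)]; omega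
      · exact Or.inl rfl
      · rw [bft_mem_three] at h00 htip; right; rw [if_pos rfl]; omega
    have hY : pe = Y := by
      rcases hm with rfl | rfl | rfl
      · rw [bft_mem_one] at h00 htip; omega
      · rw [bft_mem_two] at h00 htip; omega
      · rw [bft_mem_three] at h00 htip; omega
    rw [(bft_vert_fwd K X Y hfwd).1, (bft_vert_fwd K X Y hfwd).2,
      show X + (if m = 3 then (1 : ℤ) else 0) + (al - X - (if m = 3 then 1 else 0)) = al by ring, ← hY]
    exact ⟨hdec, rfl⟩

/-! ### Chain darts are exterior, and the walk follows the chain -/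

/-- Frame coordinates of a chain vertex. [folklore] -/
theorem bft_vert_coords (m : ℕ) (K : Fin 4) (X Y ι : ℤ) :
    (bftVert m K X Y ι).1 * (dir K).1 + (bftVert m K X Y ι).2 * (dir K).2 =
      (if m = 2 ∨ 0 ≤ ι then X + (if m = 3 then 1 else 0) + ι else X) ∧
    (bftVert m K X Y ι).1 * (dir (K + 1)).1 + (bftVert m K X Y ι).2 * (dir (K + 1)).2 =
      (if m = 2 ∨ 0 ≤ ι then Y else (if m = 3 then Y + ι else Y - 1 - ι)) := by
  by_cases h : m = 2 ∨ 0 ≤ ι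
  · simp only [bftVert, if_pos h]
    exact tp_rail_coords K _ _
  · simp only [bftVert, if_neg h]
    exact tp_rail_coords K _ _

/-- Evaluating the sector predicate about a forward chain vertex. [folklore] -/
theorem bft_mem_eval_fwd {m : ℕ} (hm : m = 1 ∨ m = 2 ∨ m = 3) {X Y ι s t : ℤ}
    (hf : m = 2 ∨ 0 ≤ ι) (hs : 0 ≤ s) :
    ((m = 1 → X ≤ (if m = 2 ∨ 0 ≤ ι then X + (if m = 3 then 1 else 0) + ι else X) + s ∧
        Y ≤ (if m = 2 ∨ 0 ≤ ι then Y else (if m = 3 then Y + ι else Y - 1 - ι)) + t) ∧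
      (m = 2 → Y ≤ (if m = 2 ∨ 0 ≤ ι then Y else (if m = 3 then Y + ι else Y - 1 - ι)) + t) ∧
      (m = 3 → Y ≤ (if m = 2 ∨ 0 ≤ ι then Y else (if m = 3 then Y + ι else Y - 1 - ι)) + t ∨
        (if m = 2 ∨ 0 ≤ ι then X + (if m = 3 then 1 else 0) + ι else X) + s ≤ X)) ↔ 0 ≤ t := by
  rw [if_pos hf, if_pos hf]
  rcases hm with rfl | rfl | rfl
  · rw [bft_mem_one, if_neg (by norm_num)]; omega
  · rw [bft_mem_two]; omega
  · rw [bft_mem_three, if_pos rfl]; omega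

/-- Evaluating the quadrant predicate about a backward chain vertex. [folklore] -/
theorem bft_mem_eval_bwd_one {X Y ι s t : ℤ} (hι : ι < 0) :
    (((1 : ℕ) = 1 → X ≤ (if (1 : ℕ) = 2 ∨ 0 ≤ ι then X + (if (1 : ℕ) = 3 then 1 else 0) + ι else X) + s ∧
        Y ≤ (if (1 : ℕ) = 2 ∨ 0 ≤ ι then Y else (if (1 : ℕ) = 3 then Y + ι else Y - 1 - ι)) + t) ∧
      ((1 : ℕ) = 2 → Y ≤ (if (1 : ℕ) = 2 ∨ 0 ≤ ι then Y else (if (1 : ℕ) = 3 then Y + ι else Y - 1 - ι)) + t) ∧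
      ((1 : ℕ) = 3 → Y ≤ (if (1 : ℕ) = 2 ∨ 0 ≤ ι then Y else (if (1 : ℕ) = 3 then Y + ι else Y - 1 - ι)) + t ∨
        (if (1 : ℕ) = 2 ∨ 0 ≤ ι then X + (if (1 : ℕ) = 3 then 1 else 0) + ι else X) + s ≤ X)) ↔
      0 ≤ s ∧ ι + 1 ≤ t := by
  have hf : ¬ ((1 : ℕ) = 2 ∨ 0 ≤ ι) := by omega
  rw [if_neg hf, if_neg hf, bft_mem_one, if_neg (by norm_num)]; omega

/-- Evaluating the co-quadrant predicate about a backward chain vertex. [folklore] -/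
theorem bft_mem_eval_bwd_three {X Y ι s t : ℤ} (hι : ι < 0) :
    (((3 : ℕ) = 1 → X ≤ (if (3 : ℕ) = 2 ∨ 0 ≤ ι then X + (if (3 : ℕ) = 3 then 1 else 0) + ι else X) + s ∧
        Y ≤ (if (3 : ℕ) = 2 ∨ 0 ≤ ι then Y else (if (3 : ℕ) = 3 then Y + ι else Y - 1 - ι)) + t) ∧
      ((3 : ℕ) = 2 → Y ≤ (if (3 : ℕ) = 2 ∨ 0 ≤ ι then Y else (if (3 : ℕ) = 3 then Y + ι else Y - 1 - ι)) + t) ∧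
      ((3 : ℕ) = 3 → Y ≤ (if (3 : ℕ) = 2 ∨ 0 ≤ ι then Y else (if (3 : ℕ) = 3 then Y + ι else Y - 1 - ι)) + t ∨
        (if (3 : ℕ) = 2 ∨ 0 ≤ ι then X + (if (3 : ℕ) = 3 then 1 else 0) + ι else X) + s ≤ X)) ↔
      -ι ≤ t ∨ s ≤ 0 := by
  have hf : ¬ ((3 : ℕ) = 2 ∨ 0 ≤ ι) := by omega
  rw [if_neg hf, if_neg hf, bft_mem_three, if_pos rfl]; omega

/-- **Chain darts are exterior and the walk follows the chain.** If on the frame box of radius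
`2` about the chain vertex `w = bftVert m K X Y ι` membership in `V` is the sector predicate,
then `w ∈ V`, `w + dir (K + bftKoff m ι) ∉ V`, and
`dsucc V (w, K + bftKoff m ι) = (bftVert m K X Y (ι + 1), K + bftKoff m (ι + 1))`.
[folklore] -/
theorem bft_ext_succ (V : Finset (ℤ × ℤ)) {m : ℕ} (hm : m = 1 ∨ m = 2 ∨ m = 3) (K : Fin 4)
    (X Y ι : ℤ)
    (hch : ∀ s t : ℤ, -2 ≤ s → s ≤ 2 → -2 ≤ t → t ≤ 2 →
      (bftVert m K X Y ι + s • dir K + t • dir (K + 1) ∈ V ↔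
        ((m = 1 → X ≤ (bftVert m K X Y ι).1 * (dir K).1 + (bftVert m K X Y ι).2 * (dir K).2 + s ∧
            Y ≤ (bftVert m K X Y ι).1 * (dir (K + 1)).1 + (bftVert m K X Y ι).2 * (dir (K + 1)).2 + t) ∧
          (m = 2 → Y ≤ (bftVert m K X Y ι).1 * (dir (K + 1)).1 + (bftVert m K X Y ι).2 * (dir (K + 1)).2 + t) ∧
          (m = 3 → Y ≤ (bftVert m K X Y ι).1 * (dir (K + 1)).1 + (bftVert m K X Y ι).2 * (dir (K + 1)).2 + t ∨
            (bftVert m K X Y ι).1 * (dir K).1 + (bftVert m K X Y ι).2 * (dir K).2 + s ≤ X)))) :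
    bftVert m K X Y ι ∈ V ∧ bftVert m K X Y ι + dir (K + bftKoff m ι) ∉ V ∧
      dsucc V (bftVert m K X Y ι, K + bftKoff m ι) =
        (bftVert m K X Y (ι + 1), K + bftKoff m (ι + 1)) := by
  obtain ⟨hcal, hcpe⟩ := bft_vert_coords m K X Y ι
  rw [hcal, hcpe] at hch
  generalize hw : bftVert m K X Y ι = w at *
  have f4 := tp_fin4 K
  have hd2 := tp_dir_add_two K
  have hd3 := tp_dir_add_three K
  have e00 : w = w + (0 : ℤ) • dir K + (0 : ℤ) • dir (K + 1) := by module
  by_cases hf : m = 2 ∨ 0 ≤ ι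
  · -- forward rail: straight step
    have hf' : m = 2 ∨ 0 ≤ ι + 1 := by omega
    have mem : ∀ s t : ℤ, 0 ≤ s → s ≤ 2 → -2 ≤ t → t ≤ 2 →
        (w + s • dir K + t • dir (K + 1) ∈ V ↔ 0 ≤ t) := fun s t hs1 hs2 ht1 ht2 => by
      rw [hch s t (by omega) hs2 ht1 ht2, bft_mem_eval_fwd hm hf hs1]
    rw [(bft_vert_fwd K X Y hf).2, (bft_vert_fwd K X Y hf').2, (bft_vert_fwd K X Y hf').1]
    have hwf := (bft_vert_fwd (m := m) K X Y hf).1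
    rw [hw] at hwf
    have h0 : w ∈ V := by
      rw [e00]; exact (mem 0 0 le_rfl (by norm_num) (by norm_num) (by norm_num)).2 le_rfl
    have h1 : w + dir (K + 3) ∉ V := by
      have e : w + dir (K + 3) = w + (0 : ℤ) • dir K + (-1 : ℤ) • dir (K + 1) := by rw [hd3]; module
      rw [e, mem 0 (-1) le_rfl (by norm_num) (by norm_num) (by norm_num)]; norm_num
    have h2 : w + dir (K + 3 + 1) ∈ V := by
      have e : w + dir (K + 3 + 1) = w + (1 : ℤ) • dir K + (0 : ℤ) • dir (K + 1) := by
        rw [f4.2.2.1]; module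
      rw [e, mem 1 0 (by norm_num) (by norm_num) (by norm_num) (by norm_num)]
    have h3 : w + dir (K + 3 + 1) + dir (K + 3) ∉ V := by
      have e : w + dir (K + 3 + 1) + dir (K + 3) = w + (1 : ℤ) • dir K + (-1 : ℤ) • dir (K + 1) := by
        rw [f4.2.2.1, hd3]; module
      rw [e, mem 1 (-1) (by norm_num) (by norm_num) (by norm_num) (by norm_num)]; norm_num
    refine ⟨h0, h1, ?_⟩
    rw [(s3_dsucc_cases V w (K + 3)).2.1 h2 h3, f4.2.2.1, hwf]
    ext <;> simp <;> ring
  · -- backward rail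
    have hι : ι < 0 := by omega
    have hm' : m = 1 ∨ m = 3 := by omega
    rcases hm' with rfl | rfl
    · -- quadrant: direction `K + 2`
      have mem : ∀ s t : ℤ, -2 ≤ s → s ≤ 2 → -2 ≤ t → t ≤ 2 →
          (w + s • dir K + t • dir (K + 1) ∈ V ↔ 0 ≤ s ∧ ι + 1 ≤ t) := fun s t hs1 hs2 ht1 ht2 => by
        rw [hch s t hs1 hs2 ht1 ht2, bft_mem_eval_bwd_one hι]
      have hwb := (bft_vert_bwd_one K X Y hι).1
      rw [hw] at hwb
      rw [(bft_vert_bwd_one K X Y hι).2]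
      have h0 : w ∈ V := by
        rw [e00]
        exact (mem 0 0 (by norm_num) (by norm_num) (by norm_num) (by norm_num)).2 ⟨le_rfl, by omega⟩
      have h1 : w + dir (K + 2) ∉ V := by
        have e : w + dir (K + 2) = w + (-1 : ℤ) • dir K + (0 : ℤ) • dir (K + 1) := by rw [hd2]; module
        rw [e, mem (-1) 0 (by norm_num) (by norm_num) (by norm_num) (by norm_num)]; omega
      refine ⟨h0, h1, ?_⟩
      have e1 : w + dir (K + 2 + 1) = w + (0 : ℤ) • dir K + (-1 : ℤ) • dir (K + 1) := by
        rw [f4.2.1, hd3]; module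
      by_cases hι1 : ι = -1
      · -- the convex turn
        subst hι1
        have hA : w + dir (K + 2 + 1) ∉ V := by
          rw [e1, mem 0 (-1) (by norm_num) (by norm_num) (by norm_num) (by norm_num)]; omega
        rw [(s3_dsucc_cases V w (K + 2)).1 hA, f4.2.1, show (-1 : ℤ) + 1 = 0 by norm_num,
          (bft_vert_fwd K X Y (Or.inr le_rfl)).1, (bft_vert_fwd K X Y (Or.inr le_rfl)).2, hwb]
        ext <;> simp
      · have hι2 : ι + 1 < 0 := by omega
        have hA : w + dir (K + 2 + 1) ∈ V := by
          rw [e1, mem 0 (-1) (by norm_num) (by norm_num) (by norm_num) (by norm_num)]; omega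
        have hB : w + dir (K + 2 + 1) + dir (K + 2) ∉ V := by
          have e : w + dir (K + 2 + 1) + dir (K + 2) = w + (-1 : ℤ) • dir K + (-1 : ℤ) • dir (K + 1) := by
            rw [f4.2.1, hd3, hd2]; module
          rw [e, mem (-1) (-1) (by norm_num) (by norm_num) (by norm_num) (by norm_num)]; omega
        rw [(s3_dsucc_cases V w (K + 2)).2.1 hA hB, (bft_vert_bwd_one K X Y hι2).1,
          (bft_vert_bwd_one K X Y hι2).2, f4.2.1, hd3, hwb]
        ext <;> simp <;> ring
    · -- co-quadrant: direction `K`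
      have mem : ∀ s t : ℤ, -2 ≤ s → s ≤ 2 → -2 ≤ t → t ≤ 2 →
          (w + s • dir K + t • dir (K + 1) ∈ V ↔ -ι ≤ t ∨ s ≤ 0) := fun s t hs1 hs2 ht1 ht2 => by
        rw [hch s t hs1 hs2 ht1 ht2, bft_mem_eval_bwd_three hι]
      have hwb := (bft_vert_bwd_three K X Y hι).1
      rw [hw] at hwb
      rw [(bft_vert_bwd_three K X Y hι).2, add_zero]
      have h0 : w ∈ V := by
        rw [e00]
        exact (mem 0 0 (by norm_num) (by norm_num) (by norm_num) (by norm_num)).2 (Or.inr le_rfl)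
      have h1 : w + dir K ∉ V := by
        have e : w + dir K = w + (1 : ℤ) • dir K + (0 : ℤ) • dir (K + 1) := by module
        rw [e, mem 1 0 (by norm_num) (by norm_num) (by norm_num) (by norm_num)]; omega
      refine ⟨h0, h1, ?_⟩
      have e1 : w + dir (K + 1) = w + (0 : ℤ) • dir K + (1 : ℤ) • dir (K + 1) := by module
      have hA : w + dir (K + 1) ∈ V := by
        rw [e1, mem 0 1 (by norm_num) (by norm_num) (by norm_num) (by norm_num)]; omega
      have e2 : w + dir (K + 1) + dir K = w + (1 : ℤ) • dir K + (1 : ℤ) • dir (K + 1) := by module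
      by_cases hι1 : ι = -1
      · -- the reflex diagonal
        subst hι1
        have hB : w + dir (K + 1) + dir K ∈ V := by
          rw [e2, mem 1 1 (by norm_num) (by norm_num) (by norm_num) (by norm_num)]; omega
        rw [(s3_dsucc_cases V w K).2.2 hA hB, show (-1 : ℤ) + 1 = 0 by norm_num,
          (bft_vert_fwd K X Y (Or.inr le_rfl)).1, (bft_vert_fwd K X Y (Or.inr le_rfl)).2, hwb]
        ext <;> simp <;> ring
      · have hι2 : ι + 1 < 0 := by omega
        have hB : w + dir (K + 1) + dir K ∉ V := by
          rw [e2, mem 1 1 (by norm_num) (by norm_num) (by norm_num) (by norm_num)]; omega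
        rw [(s3_dsucc_cases V w K).2.1 hA hB, (bft_vert_bwd_three K X Y hι2).1,
          (bft_vert_bwd_three K X Y hι2).2, add_zero, hwb]
        ext <;> simp <;> ring

/-! ### Consecutive chain vertices are adjacent -/

/-- **One step of the chain** moves the vertex by a frame displacement of size `≤ 1`.
[folklore] -/
theorem bft_vert_step {m : ℕ} (hm : m = 1 ∨ m = 2 ∨ m = 3) (K : Fin 4) (X Y ι : ℤ) :
    ∃ s t : ℤ, bftVert m K X Y (ι + 1) = bftVert m K X Y ι + s • dir K + t • dir (K + 1) ∧
      -1 ≤ s ∧ s ≤ 1 ∧ -1 ≤ t ∧ t ≤ 1 := by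
  by_cases hf : m = 2 ∨ 0 ≤ ι
  · have hf' : m = 2 ∨ 0 ≤ ι + 1 := by omega
    refine ⟨1, 0, ?_, by norm_num, by norm_num, by norm_num, by norm_num⟩
    rw [(bft_vert_fwd K X Y hf).1, (bft_vert_fwd K X Y hf').1]
    module
  · have hι : ι < 0 := by omega
    have hm' : m = 1 ∨ m = 3 := by omega
    rcases hm' with rfl | rfl
    · by_cases hι1 : ι = -1
      · subst hι1
        refine ⟨0, 0, ?_, by norm_num, by norm_num, by norm_num, by norm_num⟩
        rw [(bft_vert_bwd_one K X Y hι).1, show (-1 : ℤ) + 1 = 0 by norm_num,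
          (bft_vert_fwd K X Y (Or.inr le_rfl)).1]
        simp only [show ¬ ((1 : ℕ) = 3) by norm_num, if_false]
        module
      · have hι2 : ι + 1 < 0 := by omega
        refine ⟨0, -1, ?_, by norm_num, by norm_num, by norm_num, by norm_num⟩
        rw [(bft_vert_bwd_one K X Y hι).1, (bft_vert_bwd_one K X Y hι2).1]
        module
    · by_cases hι1 : ι = -1
      · subst hι1
        refine ⟨1, 1, ?_, by norm_num, by norm_num, by norm_num, by norm_num⟩
        rw [(bft_vert_bwd_three K X Y hι).1, show (-1 : ℤ) + 1 = 0 by norm_num,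
          (bft_vert_fwd K X Y (Or.inr le_rfl)).1]
        simp only [if_true]
        module
      · have hι2 : ι + 1 < 0 := by omega
        refine ⟨0, 1, ?_, by norm_num, by norm_num, by norm_num, by norm_num⟩
        rw [(bft_vert_bwd_three K X Y hι).1, (bft_vert_bwd_three K X Y hι2).1]
        module

/-- **A few steps of the chain** move the vertex by a frame displacement of size `≤ j`.
[folklore] -/
theorem bft_vert_shift {m : ℕ} (hm : m = 1 ∨ m = 2 ∨ m = 3) (K : Fin 4) (X Y ι : ℤ) (j : ℕ) :
    ∃ s t : ℤ, bftVert m K X Y (ι + j) = bftVert m K X Y ι + s • dir K + t • dir (K + 1) ∧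
      -(j : ℤ) ≤ s ∧ s ≤ j ∧ -(j : ℤ) ≤ t ∧ t ≤ j := by
  induction j with
  | zero => exact ⟨0, 0, by simp, by norm_num, by norm_num, by norm_num, by norm_num⟩
  | succ j ih =>
    obtain ⟨s, t, he, hs1, hs2, ht1, ht2⟩ := ih
    obtain ⟨s', t', he', hs1', hs2', ht1', ht2'⟩ := bft_vert_step hm K X Y (ι + j)
    refine ⟨s + s', t + t', ?_, by push_cast; omega, by push_cast; omega, by push_cast; omega,
      by push_cast; omega⟩
    rw [show ι + ((j + 1 : ℕ) : ℤ) = ι + j + 1 by push_cast; ring, he', he]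
    module

end Summit.CriticalPhenomena.CardyFormulaZ2.Cruxes.RectilinearCardy.ExcursionKernelCovariance

end
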